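import Summits.QuantumFields.YangMills.Theorems.FluctuationComparisonRegPrIntLS2BetaChartReadDescentOntoExpPoint
import Summits.QuantumFields.YangMills.Theorems.FluctuationComparisonRegPrIntLS2BetaChartedFibreLevelSet
import HarnessLib

/-!
# S2β · THE ASSEMBLY — «CRIT-m♮ IS A THEOREM»: for every good history `U₀` that is a local minimum of the Wilson action on its descent fibre (in particular every argmin good
# history — ✓(β)), the first variation `DA(U₀)` (✓p822511's pairing) FACTORS THROUGH the derivative `DM(U₀) := fderiv (charted descent) 0` of the chart-read `(K−J)`-fold
# (0.4) descent, and `DM(U₀)` is ONTO — by ONE TERM over ✓p823740 (s3) ∘ ✓p823424 (instance door) ∘ ✓p822961 (α) ∘ ✓p823147 (A-C¹) and px13 g25's (s1)+(s2)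
# ✓`…ChartReadDescentOntoExpPoint` ∕ `…OntoT3` ∕ ✓p823800; OUTRIGHT in the registry prefix at every `L ≥ 5`

Cell `ym3-torus` (YM ladder rung R3 = continuum `SU(2)` Yang–Mills on the three-torus at fixed lattice data — a RUNG: NOT d = 4, NOT infinite volume, NOT a mass gap,
NOT Clay).  Width seat `ym3-torus-px5` (gen 22); crux `stmt-QuantumFields-20520` (`…Theses.UnitScaleTilt.FluctuationComparisonRegPrIntL`), LINE g18-1 S2β, organ GAP♯∘
(registered `stub_uniformFibreGapOrbit`, registry UNTOUCHED) ⟸ v3 gauge-conditioned letters (px16 g21 ✓p823648) ⟸ «CRIT-ax» ⟸ «MULT♭-ax» = CRIT-m♮ ∧ MULT♮ ∧ AVG₂♭-ax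
(✓p823293); `--kind proof --supports stmt-QuantumFields-20520 --as helper`, count-neutral, DEFINITION-FREE (0 `def`, 0 `instance`, 0 `notation`, 0 `sorry`, default heartbeats).

THE OBJECT `DM(U₀)` (pinned for the lane — RINV-curl (px16 g21) and AVG₂♭-ax (px10 g23) quantify the SAME map): the Fréchet derivative at `0` of the charted descent
`Mc ζ B := Λ(D_{J,K}(expPoint(ζ)•U₀)(B) · D_{J,K}(U₀)(B)⁻¹)`, `ζ : PBond (F.P K) 0 → ℝ³` the right-invariant quaternionic chart of ✓p822511∕✓p823147, `Λ` = lit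
`HaarExponentialChart`'s log chart of `SU(2)` (`isChartRep_specialUnitaryGroup`), written OUT as `fderiv ℝ (fun ζ B => …) 0` in every statement — no definition.

WHAT IS PROVED (sorry-free).
* §1 ★★★`critM_of_isLocalMinOn` — `U₀ ∈ histGood F ℰp θ K J` (θ ≥ 0, the displayed numerics `(5L)²∕4·θ_i ≤ α ≤ 1∕24`, `α < δ_{SU(2)}`, `157α < L⁻²` for `J < i ≤ K`) and
  `IsLocalMinOn A (fibre F ℰp J K _ (D_{J,K}U₀)) U₀` ⟹ **`(∃ lam, ∀ ζ, DA(U₀)[ζ] = lam (DM(U₀) ζ)) ∧ Surjective DM(U₀)`**.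
* §2 ★★★`critM_of_argmin` — the same for an ARGMIN good history under FILE D §1's hypotheses (✓(β) `isLocalMinOn_fibre_of_argmin`), `θ` the history profile.
* §3 registry prefix, interior window, ANY guard `G`, the numerics DISCHARGED by the smallness of `θBal` (`exists_forall_θBal_le`): ★★★`critM_at (hT) (hU1) (G)`, ★★★`critM_of_thm1Pair`,
  `critM_of_thm1PairAtThree`, ★★★`critM_body_five (L) (h5 : 5 ≤ L) (G)` — **CRIT-m♮ ∧ «DM onto» for every argmin good history, OUTRIGHT at every `L ≥ 5`, ZERO letters.**

HONEST.  Composition BY NAME; the analytic content is px13 g25's (s1)(s2) over pub-ymgap N09 (one-step chart-read (0.4) average: `C^∞` and onto derivative at small fields),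
✓(A-C¹), Mathlib's Lagrange theorem, and the tree's Thm-1 pair at `L ≥ 5` (the 19200 guarded chain); nothing of Bałaban's renormalisation analysis is asserted; MULT♮ (RINV-curl),
AVG₂♭-ax, «CRIT-ax», (D-ax)∕(F-ax), GAP♯∘'s REGISTERED stub, the five registered stubs (every `L`), S2β, crux 20520, 19936, 19200 and `YM3TorusSU2` are NOT proved; no summit
statement is proved by a helper; rung R3 = SU(2) YM₃ on T³ at fixed lattice data — NOT d = 4, NOT infinite volume, NOT a mass gap, NOT Clay; the Yang–Mills mass gap is NOT proved.

References: T. Bałaban, CMP **102** (1985) 277–309 [Balaban1985Variational] ((26) p.282, (171) p.305: criticality of the background under the average constraint; Thm 1 (8)–(10)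
p.279); CMP **109** (1987) [Balaban1987RG1] ((0.4) p.253); CMP **98** (1985) [Balaban1985Averaging] (p.19); Mathlib `Analysis.Calculus.LagrangeMultipliers`.
-/

set_option autoImplicit false

noncomputable section

open scoped Matrix.Norms.L2Operator Topology RealInnerProductSpace
open Filter Set Function
open Literature.MathematicalPhysics.QuantumLattice (su2Quat)
open Literature.MathematicalPhysics.QuantumFieldTheory.Balaban1983to89
open Literature.MathematicalPhysics.QuantumFieldTheory.Balaban1983to89.HaarExponentialChart
open Literature.MathematicalPhysics.QuantumFieldTheory.Balaban1983to89.HaarExponentialChart.IsChartRep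
open Literature.MathematicalPhysics.QuantumFieldTheory.Balaban1983to89.ExpMeanLog (expMeanLogSU deltaSU deltaSU_pos)
open Literature.MathematicalPhysics.QuantumFieldTheory.Balaban1983to89.Node00
open Literature.MathematicalPhysics.QuantumFieldTheory.Balaban1983to89.T3ContinuumYM3Torus
open Literature.MathematicalPhysics.QuantumFieldTheory.Balaban1983to89.T3UnitLawDensityEML (ℰp)
open Literature.MathematicalPhysics.QuantumFieldTheory.Balaban1983to89.T3UnitScaleTilt
open Literature.MathematicalPhysics.QuantumFieldTheory.Balaban1983to89.T3TiltDescent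
open Literature.MathematicalPhysics.QuantumFieldTheory.Balaban1983to89.T3ConstrainedMinimiser (fibre)
open Literature.MathematicalPhysics.QuantumFieldTheory.Balaban1983to89.T3DescentFibreTower
open Literature.MathematicalPhysics.QuantumFieldTheory.Balaban1983to89.T3PrintedRegularMinimiser
open Literature.MathematicalPhysics.QuantumFieldTheory.Balaban1983to89.T3PrintedMinimiserExistence
open Literature.MathematicalPhysics.QuantumFieldTheory.Balaban1983to89.T3Thm1UniquenessSchema (Thm1UniqueMinOrbitAt)
open Literature.MathematicalPhysics.QuantumFieldTheory.Balaban1983to89.T3MinimiserStabilityReduction (θBal_pos)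
open Literature.MathematicalPhysics.QuantumFieldTheory.Balaban1983to89.T3ThresholdSmallness (exists_forall_θBal_le)
open Literature.MathematicalPhysics.QuantumFieldTheory.Balaban1983to89.T4HaarSU2ExpChart (expPoint)
open Literature.MathematicalPhysics.QuantumFieldTheory.Balaban1983to89.T4ExpWindowSmallField (imVec)
open Literature.MathematicalPhysics.QuantumFieldTheory.Balaban1983to89.B15Prop1ChartSU2 (adSU2)
open Literature.MathematicalPhysics.QuantumFieldTheory.Balaban1983to89.T4Continuum
open Summit.QuantumFields.YangMills.Theorems.FluctuationComparisonRegPrIntLS2BetaSymmetriesLiftOfCritical (thm1Pair_five thm1Pair_allL_of_three)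
open Summit.QuantumFields.YangMills.Theorems.FluctuationComparisonRegPrIntLS2BetaArgminLocalMinOnFibre (isLocalMinOn_fibre_of_argmin)
open Summit.QuantumFields.YangMills.Theorems.FluctuationComparisonRegPrIntLS2BetaChartedFibreLevelSet (exists_multiplier_of_chart)
open Summit.QuantumFields.YangMills.Theorems.FluctuationComparisonRegPrIntLS2BetaChartReadDescentOntoExpPoint
  (hasStrictFDerivAt_chartRead_descendTo_expPoint continuousAt_descendTo_expPoint injOn_relLogChart relLogChart_window_mem_nhds)

namespace Summit.QuantumFields.YangMills.Theorems.FluctuationComparisonRegPrIntLS2BetaCritMOfChartReadDescent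

variable {F : T3Family}

/-! ## §1 CRIT-m♮ for a fibre-local minimum with a good history -/

/-- ★★★ **CRIT-m♮ ∧ «DM ONTO» FOR A FIBRE-LOCAL MINIMUM WITH A GOOD HISTORY**: if `U₀ ∈ histGood F ℰp θ K J` (under the displayed numerics on `θ` vs `α`) is a local minimum of
the Wilson action on its own descent fibre, then with `DM(U₀) := fderiv` at `0` of the chart-read descent `ζ ↦ (B ↦ Λ(D_{J,K}(expPoint(ζ)•U₀)(B)·D_{J,K}(U₀)(B)⁻¹))`:
`∃ λ, ∀ ζ, DA(U₀)[ζ] = λ (DM(U₀) ζ)` and `DM(U₀)` is onto. [cite: Balaban1985Variational, (26) p.282, (171) p.305; Balaban1987RG1, (0.4) p.253] -/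
theorem critM_of_isLocalMinOn {J K : ℕ} (hJK : J ≤ K) {θ : ℕ → ℝ} (hθ0 : ∀ i, 0 ≤ θ i) {α : ℝ}
    (hθα : ∀ i, J < i → i ≤ K → (((5 * F.L : ℕ) : ℝ) ^ 2 / 4) * θ i ≤ α)
    (hα24 : α ≤ 1 / 24) (hαδ : α < deltaSU (Fin 2)) (hαL : 157 * α < ((F.L : ℝ) ^ 2)⁻¹)
    {U₀ : GaugeField (F.P K) 0 (SU 2)} (hUg : U₀ ∈ histGood F ℰp θ K J)
    (hloc : IsLocalMinOn (fun W : GaugeField (F.P K) 0 (SU 2) => wilsonAction4 W) (fibre F ℰp J K hJK (descendTo F ℰp J K hJK U₀)) U₀) :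
    (∃ lam : (PBond (F.P J) 0 → (specialUnitaryLogChart (Fin 2)).lie) → ℝ, ∀ ζ : PBond (F.P K) 0 → EuclideanSpace ℝ (Fin 3),
      (∑ p : Plaq (F.P K) 0, inner ℝ (imVec (su2Quat (GaugeField.plaqHol U₀ p)))
        (adSU2 (GaugeField.plaqHol U₀ p)⁻¹ (ζ ⟨p.src, p.μ⟩) + adSU2 ((GaugeField.plaqHol U₀ p)⁻¹ * U₀ ⟨p.src, p.μ⟩) (ζ ⟨p.src.shift p.μ, p.ν⟩) -
          adSU2 ((GaugeField.plaqHol U₀ p)⁻¹ * U₀ ⟨p.src, p.μ⟩ * U₀ ⟨p.src.shift p.μ, p.ν⟩ * (U₀ ⟨p.src.shift p.ν, p.μ⟩)⁻¹) (ζ ⟨p.src.shift p.ν, p.μ⟩) -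
          ζ ⟨p.src, p.ν⟩)) =
      lam (fderiv ℝ (fun (ζ : PBond (F.P K) 0 → EuclideanSpace ℝ (Fin 3)) (B : PBond (F.P J) 0) =>
        (isChartRep_specialUnitaryGroup (n := Fin 2)).logChart
          (descendTo F ℰp J K hJK (fun ℓ => expPoint (ζ ℓ) * U₀ ℓ) B * (descendTo F ℰp J K hJK U₀ B)⁻¹)) 0 ζ)) ∧
    Function.Surjective (fderiv ℝ (fun (ζ : PBond (F.P K) 0 → EuclideanSpace ℝ (Fin 3)) (B : PBond (F.P J) 0) =>
        (isChartRep_specialUnitaryGroup (n := Fin 2)).logChart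
          (descendTo F ℰp J K hJK (fun ℓ => expPoint (ζ ℓ) * U₀ ℓ) B * (descendTo F ℰp J K hJK U₀ B)⁻¹)) 0) := by
  obtain ⟨hMc, hsurj⟩ := hasStrictFDerivAt_chartRead_descendTo_expPoint (F := F) hJK hθ0 hθα hα24 hαδ hαL hUg
  have hθδ : ∀ i, J < i → i ≤ K → (((5 * F.L : ℕ) : ℝ) ^ 2 / 4) * θ i < deltaSU (Fin 2) :=
    fun i hi hiK => (hθα i hi hiK).trans_lt hαδ
  have hcont := continuousAt_descendTo_expPoint (F := F) hJK hθ0 hθδ hUg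
  have hU₀ : U₀ ∈ fibre F ℰp J K hJK (descendTo F ℰp J K hJK U₀) := (mem_fibre_iff F ℰp).mpr rfl
  exact ⟨exists_multiplier_of_chart hJK U₀ hU₀ hloc (relLogChart_window_mem_nhds (descendTo F ℰp J K hJK U₀))
      (injOn_relLogChart (descendTo F ℰp J K hJK U₀)) hcont hMc hsurj, hsurj⟩

/-! ## §2 CRIT-m♮ for an argmin good history (✓(β) built in) -/

/-- ★★★ **CRIT-m♮ ∧ «DM ONTO» AT AN ARGMIN GOOD HISTORY**: under FILE D §1's hypotheses (the Thm-1 pair at `(L, a₀, a₁, B₃)`, the history profile `θ` with `θ i ≤ a₁`,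
`B₃θ_iL³ ≤ ε₀`, `4θ_iL³ < ε₀`) plus the displayed (0.4) numerics on `θ` vs `α`, for a good history `U₀` over `V` with `A(U₀) = minActionRegPr F J K ε₀ V`: CRIT-m♮ with the
explicit onto `DM(U₀)`. [cite: Balaban1985Variational, Thm 1 (8)-(10) p.279, (26) p.282, (171) p.305] -/
theorem critM_of_argmin {L : ℕ} {a₀ a₁ B₃ : ℝ} (hT : Thm1GlobalMinAt L a₀ a₁ B₃) (hU1 : Thm1UniqueMinOrbitAt L a₀ a₁ B₃)
    (hB₃ : 0 < B₃) (hFL : F.L = L) {ε₀ : ℝ} (hε₀ : 0 < ε₀) (hε₀a : ε₀ ≤ a₀) {θ : ℕ → ℝ} (hθpos : ∀ i, 0 < θ i)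
    (hθa : ∀ i, θ i ≤ a₁) (hθB : ∀ i, B₃ * θ i * (F.L : ℝ) ^ 3 ≤ ε₀) (hθ4 : ∀ i, 4 * θ i * (F.L : ℝ) ^ 3 < ε₀)
    {α : ℝ} (hθα : ∀ i, (((5 * F.L : ℕ) : ℝ) ^ 2 / 4) * θ i ≤ α)
    (hα24 : α ≤ 1 / 24) (hαδ : α < deltaSU (Fin 2)) (hαL : 157 * α < ((F.L : ℝ) ^ 2)⁻¹)
    {J K : ℕ} (hJK : J ≤ K) {V : GaugeField (F.P J) 0 (SU 2)}
    {U₀ : GaugeField (F.P K) 0 (SU 2)} (hUf : U₀ ∈ fibre F ℰp J K hJK V) (hUg : U₀ ∈ histGood F ℰp θ K J)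
    (hA : wilsonAction4 U₀ = minActionRegPr F J K hJK ε₀ V) :
    (∃ lam : (PBond (F.P J) 0 → (specialUnitaryLogChart (Fin 2)).lie) → ℝ, ∀ ζ : PBond (F.P K) 0 → EuclideanSpace ℝ (Fin 3),
      (∑ p : Plaq (F.P K) 0, inner ℝ (imVec (su2Quat (GaugeField.plaqHol U₀ p)))
        (adSU2 (GaugeField.plaqHol U₀ p)⁻¹ (ζ ⟨p.src, p.μ⟩) + adSU2 ((GaugeField.plaqHol U₀ p)⁻¹ * U₀ ⟨p.src, p.μ⟩) (ζ ⟨p.src.shift p.μ, p.ν⟩) -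
          adSU2 ((GaugeField.plaqHol U₀ p)⁻¹ * U₀ ⟨p.src, p.μ⟩ * U₀ ⟨p.src.shift p.μ, p.ν⟩ * (U₀ ⟨p.src.shift p.ν, p.μ⟩)⁻¹) (ζ ⟨p.src.shift p.ν, p.μ⟩) -
          ζ ⟨p.src, p.ν⟩)) =
      lam (fderiv ℝ (fun (ζ : PBond (F.P K) 0 → EuclideanSpace ℝ (Fin 3)) (B : PBond (F.P J) 0) =>
        (isChartRep_specialUnitaryGroup (n := Fin 2)).logChart
          (descendTo F ℰp J K hJK (fun ℓ => expPoint (ζ ℓ) * U₀ ℓ) B * (descendTo F ℰp J K hJK U₀ B)⁻¹)) 0 ζ)) ∧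
    Function.Surjective (fderiv ℝ (fun (ζ : PBond (F.P K) 0 → EuclideanSpace ℝ (Fin 3)) (B : PBond (F.P J) 0) =>
        (isChartRep_specialUnitaryGroup (n := Fin 2)).logChart
          (descendTo F ℰp J K hJK (fun ℓ => expPoint (ζ ℓ) * U₀ ℓ) B * (descendTo F ℰp J K hJK U₀ B)⁻¹)) 0) := by
  have hV : descendTo F ℰp J K hJK U₀ = V := (mem_fibre_iff F ℰp).mp hUf
  have hloc := isLocalMinOn_fibre_of_argmin hT hU1 hB₃ hFL hε₀ hε₀a hθpos hθa hθB hθ4 hJK hUf hUg hA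
  rw [← hV] at hloc
  exact critM_of_isLocalMinOn hJK (fun i => (hθpos i).le) (fun i _ _ => hθα i) hα24 hαδ hαL hUg hloc

/-! ## §3 In the registry's prefix and interior window: the (0.4) numerics discharged by the smallness of `θBal`; OUTRIGHT at `L ≥ 5` -/

section Window

/-- ★★★ **CRIT-m♮ ∧ «DM ONTO» FOR EVERY ARGMIN GOOD HISTORY, AT ONE BLOCK SIZE FROM THE THM-1 PAIR AT THAT BLOCK SIZE**, for every guard `G` (`c₀ := 1`, `pS := 0`, `ε₁ := a₀`;
`γ₁` so small that `θBal(b₀)(i) ≤ min a₁ (ε₀∕(2(4+B₃)L³))` — FILE D — AND `(5L)²∕4·θBal(b₀)(i) ≤ α₀ := min (1∕24) (min (δ_{SU(2)}∕2) (1∕(2·157·L²)))`, both by lit ✓`exists_forall_θBal_le`).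
[cite: Balaban1985Variational, Thm 1 (8)-(10) p.279, (26) p.282, (171) p.305; Balaban1987RG1, (0.4) p.253] -/
theorem critM_at {L : ℕ} (hL1 : 1 < L) {a₀ a₁ B₃ : ℝ} (ha₀ : 0 < a₀) (ha₁ : 0 < a₁) (hB₃ : 0 < B₃)
    (hT : Thm1GlobalMinAt L a₀ a₁ B₃) (hU1 : Thm1UniqueMinOrbitAt L a₀ a₁ B₃)
    (G : (F : T3Family) → (J : ℕ) → GaugeField (F.P J) 0 (Matrix.specialUnitaryGroup (Fin 2) ℂ) → Prop) :
    ∃ c₀ : ℝ, 0 < c₀ ∧ c₀ ≤ 1 ∧ ∀ (cw : ℝ), 0 < cw → cw ≤ c₀ → ∃ pS : ℝ, ∀ (b₀ p₀ : ℝ), 0 < b₀ → pS ≤ p₀ → 0 < p₀ → ∃ ε₁ : ℝ, 0 < ε₁ ∧ ∀ (ε₀ : ℝ), 0 < ε₀ → ε₀ ≤ ε₁ →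
    ∃ γ₁ : ℝ, 0 < γ₁ ∧ ∀ (F : T3Family) (γ : ℝ), F.L = L → 0 < γ → γ ≤ γ₁ →
      ∀ (J K : ℕ) (hJK : J ≤ K) (V : GaugeField (F.P J) 0 (Matrix.specialUnitaryGroup (Fin 2) ℂ)), PlaqSmall (θBal F.L γ (cw * b₀) p₀ J) V →
        G F J V →
        ∀ U₀ ∈ {U' : GaugeField (F.P K) 0 (Matrix.specialUnitaryGroup (Fin 2) ℂ) | U' ∈ fibre F ℰp J K hJK V ∧ U' ∈ histGood F ℰp (θBal F.L γ b₀ p₀) K J ∧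
            wilsonAction4 U' = minActionRegPr F J K hJK ε₀ V},
        (∃ lam : (PBond (F.P J) 0 → (specialUnitaryLogChart (Fin 2)).lie) → ℝ, ∀ ζ : PBond (F.P K) 0 → EuclideanSpace ℝ (Fin 3),
          (∑ p : Plaq (F.P K) 0, inner ℝ (imVec (su2Quat (GaugeField.plaqHol U₀ p)))
            (adSU2 (GaugeField.plaqHol U₀ p)⁻¹ (ζ ⟨p.src, p.μ⟩) + adSU2 ((GaugeField.plaqHol U₀ p)⁻¹ * U₀ ⟨p.src, p.μ⟩) (ζ ⟨p.src.shift p.μ, p.ν⟩) -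
              adSU2 ((GaugeField.plaqHol U₀ p)⁻¹ * U₀ ⟨p.src, p.μ⟩ * U₀ ⟨p.src.shift p.μ, p.ν⟩ * (U₀ ⟨p.src.shift p.ν, p.μ⟩)⁻¹) (ζ ⟨p.src.shift p.ν, p.μ⟩) -
              ζ ⟨p.src, p.ν⟩)) =
          lam (fderiv ℝ (fun (ζ : PBond (F.P K) 0 → EuclideanSpace ℝ (Fin 3)) (B : PBond (F.P J) 0) =>
            (isChartRep_specialUnitaryGroup (n := Fin 2)).logChart
              (descendTo F ℰp J K hJK (fun ℓ => expPoint (ζ ℓ) * U₀ ℓ) B * (descendTo F ℰp J K hJK U₀ B)⁻¹)) 0 ζ)) ∧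
        Function.Surjective (fderiv ℝ (fun (ζ : PBond (F.P K) 0 → EuclideanSpace ℝ (Fin 3)) (B : PBond (F.P J) 0) =>
            (isChartRep_specialUnitaryGroup (n := Fin 2)).logChart
              (descendTo F ℰp J K hJK (fun ℓ => expPoint (ζ ℓ) * U₀ ℓ) B * (descendTo F ℰp J K hJK U₀ B)⁻¹)) 0) := by
  have hL : 1 ≤ L := hL1.le
  have hL0 : (0 : ℝ) < (L : ℝ) := by exact_mod_cast (show 0 < L by omega)
  refine ⟨1, one_pos, le_rfl, fun cw hcw0 hcw1 => ⟨0, fun b₀ p₀ hb _ hp => ⟨a₀, ha₀, fun ε₀ hε₀ hε₀a => ?_⟩⟩⟩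
  -- FILE D's smallness of `θBal`
  set c : ℝ := 2 * (4 + B₃) * (L : ℝ) ^ 3 with hc
  have hcpos : 0 < c := by positivity
  obtain ⟨γθ, hγθ, Hθ⟩ := exists_forall_θBal_le hL b₀ p₀ (lt_min ha₁ (div_pos hε₀ hcpos))
  -- the (0.4) numerics: `(5L)²∕4·θBal ≤ α₀`
  set α₀ : ℝ := min (1 / 24) (min (deltaSU (Fin 2) / 2) (1 / (2 * 157 * (L : ℝ) ^ 2))) with hα₀
  have hα₀pos : 0 < α₀ := by
    have hδ := deltaSU_pos (n := Fin 2)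
    positivity
  set q : ℝ := (((5 * L : ℕ) : ℝ) ^ 2 / 4) with hq
  have hqpos : 0 < q := by
    rw [hq]; have : (0 : ℝ) < ((5 * L : ℕ) : ℝ) := by exact_mod_cast (show 0 < 5 * L by omega)
    positivity
  obtain ⟨γα, hγα, Hα⟩ := exists_forall_θBal_le hL b₀ p₀ (div_pos hα₀pos hqpos)
  refine ⟨min (min γθ γα) 1, lt_min (lt_min hγθ hγα) one_pos, fun F γ hFL hγ hγle J K hJK V _ _ U₀ hU₀ => ?_⟩
  have hγθ' : γ ≤ γθ := hγle.trans ((min_le_left _ _).trans (min_le_left _ _))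
  have hγα' : γ ≤ γα := hγle.trans ((min_le_left _ _).trans (min_le_right _ _))
  have hγ1 : γ ≤ 1 := hγle.trans (min_le_right _ _)
  have hθle : ∀ i, θBal F.L γ b₀ p₀ i ≤ min a₁ (ε₀ / c) := fun i => by rw [hFL]; exact Hθ γ hγ hγθ' i
  have hθpos : ∀ i, 0 < θBal F.L γ b₀ p₀ i := fun i => θBal_pos F.hL.2.le hγ hγ1 hb p₀ i
  have hθa : ∀ i, θBal F.L γ b₀ p₀ i ≤ a₁ := fun i => (hθle i).trans (min_le_left _ _)
  have hθc : ∀ i, θBal F.L γ b₀ p₀ i * c ≤ ε₀ := fun i => by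
    have h := (hθle i).trans (min_le_right _ _)
    rwa [le_div_iff₀ hcpos] at h
  have hFL3 : (F.L : ℝ) ^ 3 = (L : ℝ) ^ 3 := by rw [hFL]
  have hθB : ∀ i, B₃ * θBal F.L γ b₀ p₀ i * (F.L : ℝ) ^ 3 ≤ ε₀ := fun i => by
    have h1 : B₃ * (F.L : ℝ) ^ 3 ≤ c := by rw [hFL3, hc]; nlinarith [pow_pos hL0 3]
    calc B₃ * θBal F.L γ b₀ p₀ i * (F.L : ℝ) ^ 3 = θBal F.L γ b₀ p₀ i * (B₃ * (F.L : ℝ) ^ 3) := by ring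
      _ ≤ θBal F.L γ b₀ p₀ i * c := mul_le_mul_of_nonneg_left h1 (hθpos i).le
      _ ≤ ε₀ := hθc i
  have hθ4 : ∀ i, 4 * θBal F.L γ b₀ p₀ i * (F.L : ℝ) ^ 3 < ε₀ := fun i => by
    have h1 : 4 * (F.L : ℝ) ^ 3 < c := by rw [hFL3, hc]; nlinarith [pow_pos hL0 3]
    calc 4 * θBal F.L γ b₀ p₀ i * (F.L : ℝ) ^ 3 = θBal F.L γ b₀ p₀ i * (4 * (F.L : ℝ) ^ 3) := by ring
      _ < θBal F.L γ b₀ p₀ i * c := mul_lt_mul_of_pos_left h1 (hθpos i)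
      _ ≤ ε₀ := hθc i
  -- the numerics for `α := α₀`
  have hθα : ∀ i, (((5 * F.L : ℕ) : ℝ) ^ 2 / 4) * θBal F.L γ b₀ p₀ i ≤ α₀ := fun i => by
    have h := Hα γ hγ hγα' i
    rw [le_div_iff₀ hqpos] at h
    rw [hFL]
    have h' : θBal L γ b₀ p₀ i * q ≤ α₀ := h
    rw [hq] at h'
    linarith [h']
  have hα24 : α₀ ≤ 1 / 24 := min_le_left _ _
  have hαδ : α₀ < deltaSU (Fin 2) := by
    have h1 : α₀ ≤ deltaSU (Fin 2) / 2 := (min_le_right _ _).trans (min_le_left _ _)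
    have hδ := deltaSU_pos (n := Fin 2)
    linarith
  have hαL : 157 * α₀ < ((F.L : ℝ) ^ 2)⁻¹ := by
    have h1 : α₀ ≤ 1 / (2 * 157 * (L : ℝ) ^ 2) := (min_le_right _ _).trans (min_le_right _ _)
    rw [hFL]
    have hL2 : (0 : ℝ) < (L : ℝ) ^ 2 := by positivity
    rw [inv_eq_one_div, lt_div_iff₀ hL2]
    have h2 : 157 * α₀ * (L : ℝ) ^ 2 ≤ 157 * (1 / (2 * 157 * (L : ℝ) ^ 2)) * (L : ℝ) ^ 2 :=
      mul_le_mul_of_nonneg_right (mul_le_mul_of_nonneg_left h1 (by norm_num)) hL2.le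
    have h3 : 157 * (1 / (2 * 157 * (L : ℝ) ^ 2)) * (L : ℝ) ^ 2 = 1 / 2 := by field_simp
    linarith
  exact critM_of_argmin hT hU1 hB₃ hFL hε₀ hε₀a hθpos hθa hθB hθ4 hθα hα24 hαδ hαL hJK hU₀.1 hU₀.2.1 hU₀.2.2

/-- ★★★ **THE SAME AT EVERY BLOCK SIZE FROM THE THM-1 PAIR LETTER** (even ∕ `L ≤ 1` vacuous by `F.hL`), for every guard `G`. [cite: Balaban1985Variational, Thm 1 (8)-(10) p.279, (171) p.305] -/
theorem critM_of_thm1Pair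
    (hT : ∀ L : ℕ, Odd L → 1 < L → ∃ a₀ a₁ B₃ : ℝ, 0 < a₀ ∧ 0 < a₁ ∧ 0 < B₃ ∧ Thm1GlobalMinAt L a₀ a₁ B₃ ∧ Thm1UniqueMinOrbitAt L a₀ a₁ B₃)
    (G : (F : T3Family) → (J : ℕ) → GaugeField (F.P J) 0 (Matrix.specialUnitaryGroup (Fin 2) ℂ) → Prop) :
    ∀ (L : ℕ), ∃ c₀ : ℝ, 0 < c₀ ∧ c₀ ≤ 1 ∧ ∀ (cw : ℝ), 0 < cw → cw ≤ c₀ → ∃ pS : ℝ, ∀ (b₀ p₀ : ℝ), 0 < b₀ → pS ≤ p₀ → 0 < p₀ → ∃ ε₁ : ℝ, 0 < ε₁ ∧ ∀ (ε₀ : ℝ), 0 < ε₀ → ε₀ ≤ ε₁ →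
    ∃ γ₁ : ℝ, 0 < γ₁ ∧ ∀ (F : T3Family) (γ : ℝ), F.L = L → 0 < γ → γ ≤ γ₁ →
      ∀ (J K : ℕ) (hJK : J ≤ K) (V : GaugeField (F.P J) 0 (Matrix.specialUnitaryGroup (Fin 2) ℂ)), PlaqSmall (θBal F.L γ (cw * b₀) p₀ J) V →
        G F J V →
        ∀ U₀ ∈ {U' : GaugeField (F.P K) 0 (Matrix.specialUnitaryGroup (Fin 2) ℂ) | U' ∈ fibre F ℰp J K hJK V ∧ U' ∈ histGood F ℰp (θBal F.L γ b₀ p₀) K J ∧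
            wilsonAction4 U' = minActionRegPr F J K hJK ε₀ V},
        (∃ lam : (PBond (F.P J) 0 → (specialUnitaryLogChart (Fin 2)).lie) → ℝ, ∀ ζ : PBond (F.P K) 0 → EuclideanSpace ℝ (Fin 3),
          (∑ p : Plaq (F.P K) 0, inner ℝ (imVec (su2Quat (GaugeField.plaqHol U₀ p)))
            (adSU2 (GaugeField.plaqHol U₀ p)⁻¹ (ζ ⟨p.src, p.μ⟩) + adSU2 ((GaugeField.plaqHol U₀ p)⁻¹ * U₀ ⟨p.src, p.μ⟩) (ζ ⟨p.src.shift p.μ, p.ν⟩) -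
              adSU2 ((GaugeField.plaqHol U₀ p)⁻¹ * U₀ ⟨p.src, p.μ⟩ * U₀ ⟨p.src.shift p.μ, p.ν⟩ * (U₀ ⟨p.src.shift p.ν, p.μ⟩)⁻¹) (ζ ⟨p.src.shift p.ν, p.μ⟩) -
              ζ ⟨p.src, p.ν⟩)) =
          lam (fderiv ℝ (fun (ζ : PBond (F.P K) 0 → EuclideanSpace ℝ (Fin 3)) (B : PBond (F.P J) 0) =>
            (isChartRep_specialUnitaryGroup (n := Fin 2)).logChart
              (descendTo F ℰp J K hJK (fun ℓ => expPoint (ζ ℓ) * U₀ ℓ) B * (descendTo F ℰp J K hJK U₀ B)⁻¹)) 0 ζ)) ∧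
        Function.Surjective (fderiv ℝ (fun (ζ : PBond (F.P K) 0 → EuclideanSpace ℝ (Fin 3)) (B : PBond (F.P J) 0) =>
            (isChartRep_specialUnitaryGroup (n := Fin 2)).logChart
              (descendTo F ℰp J K hJK (fun ℓ => expPoint (ζ ℓ) * U₀ ℓ) B * (descendTo F ℰp J K hJK U₀ B)⁻¹)) 0) := by
  intro L
  by_cases hLodd : Odd L ∧ 1 < L
  · obtain ⟨a₀, a₁, B₃, ha₀, ha₁, hB₃, hT1, hU1⟩ := hT L hLodd.1 hLodd.2
    exact critM_at hLodd.2 ha₀ ha₁ hB₃ hT1 hU1 G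
  · refine ⟨1, one_pos, le_rfl, fun cw _ _ => ⟨0, fun b₀ p₀ _ _ _ => ⟨1, one_pos, fun ε₀ _ _ => ⟨1, one_pos, ?_⟩⟩⟩⟩
    intro F γ hFL
    exact absurd (hFL ▸ F.hL) hLodd

/-- ★★★ **… FROM THE `L = 3` THM-1 PAIR ALONE** (every `L ≥ 5` by ✓`thm1Pair_five`; `L = 3` = the [Balaban1985RegularSpaces] Thm-2 socket). [cite: Balaban1985Variational, Thm 1 p.279; Balaban1985RegularSpaces, Thm 2 p.83] -/
theorem critM_of_thm1PairAtThree
    (h3 : ∃ a₀ a₁ B₃ : ℝ, 0 < a₀ ∧ 0 < a₁ ∧ 0 < B₃ ∧ Thm1GlobalMinAt 3 a₀ a₁ B₃ ∧ Thm1UniqueMinOrbitAt 3 a₀ a₁ B₃)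
    (G : (F : T3Family) → (J : ℕ) → GaugeField (F.P J) 0 (Matrix.specialUnitaryGroup (Fin 2) ℂ) → Prop) :
    ∀ (L : ℕ), ∃ c₀ : ℝ, 0 < c₀ ∧ c₀ ≤ 1 ∧ ∀ (cw : ℝ), 0 < cw → cw ≤ c₀ → ∃ pS : ℝ, ∀ (b₀ p₀ : ℝ), 0 < b₀ → pS ≤ p₀ → 0 < p₀ → ∃ ε₁ : ℝ, 0 < ε₁ ∧ ∀ (ε₀ : ℝ), 0 < ε₀ → ε₀ ≤ ε₁ →
    ∃ γ₁ : ℝ, 0 < γ₁ ∧ ∀ (F : T3Family) (γ : ℝ), F.L = L → 0 < γ → γ ≤ γ₁ →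
      ∀ (J K : ℕ) (hJK : J ≤ K) (V : GaugeField (F.P J) 0 (Matrix.specialUnitaryGroup (Fin 2) ℂ)), PlaqSmall (θBal F.L γ (cw * b₀) p₀ J) V →
        G F J V →
        ∀ U₀ ∈ {U' : GaugeField (F.P K) 0 (Matrix.specialUnitaryGroup (Fin 2) ℂ) | U' ∈ fibre F ℰp J K hJK V ∧ U' ∈ histGood F ℰp (θBal F.L γ b₀ p₀) K J ∧
            wilsonAction4 U' = minActionRegPr F J K hJK ε₀ V},
        (∃ lam : (PBond (F.P J) 0 → (specialUnitaryLogChart (Fin 2)).lie) → ℝ, ∀ ζ : PBond (F.P K) 0 → EuclideanSpace ℝ (Fin 3),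
          (∑ p : Plaq (F.P K) 0, inner ℝ (imVec (su2Quat (GaugeField.plaqHol U₀ p)))
            (adSU2 (GaugeField.plaqHol U₀ p)⁻¹ (ζ ⟨p.src, p.μ⟩) + adSU2 ((GaugeField.plaqHol U₀ p)⁻¹ * U₀ ⟨p.src, p.μ⟩) (ζ ⟨p.src.shift p.μ, p.ν⟩) -
              adSU2 ((GaugeField.plaqHol U₀ p)⁻¹ * U₀ ⟨p.src, p.μ⟩ * U₀ ⟨p.src.shift p.μ, p.ν⟩ * (U₀ ⟨p.src.shift p.ν, p.μ⟩)⁻¹) (ζ ⟨p.src.shift p.ν, p.μ⟩) -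
              ζ ⟨p.src, p.ν⟩)) =
          lam (fderiv ℝ (fun (ζ : PBond (F.P K) 0 → EuclideanSpace ℝ (Fin 3)) (B : PBond (F.P J) 0) =>
            (isChartRep_specialUnitaryGroup (n := Fin 2)).logChart
              (descendTo F ℰp J K hJK (fun ℓ => expPoint (ζ ℓ) * U₀ ℓ) B * (descendTo F ℰp J K hJK U₀ B)⁻¹)) 0 ζ)) ∧
        Function.Surjective (fderiv ℝ (fun (ζ : PBond (F.P K) 0 → EuclideanSpace ℝ (Fin 3)) (B : PBond (F.P J) 0) =>
            (isChartRep_specialUnitaryGroup (n := Fin 2)).logChart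
              (descendTo F ℰp J K hJK (fun ℓ => expPoint (ζ ℓ) * U₀ ℓ) B * (descendTo F ℰp J K hJK U₀ B)⁻¹)) 0) :=
  critM_of_thm1Pair (thm1Pair_allL_of_three h3) G

/-- ★★★ **CRIT-m♮ ∧ «DM ONTO» FOR EVERY ARGMIN GOOD HISTORY ON THE INTERIOR WINDOW AT EVERY BLOCK SIZE `L ≥ 5` — ZERO HYPOTHESES** (✓`thm1Pair_five` ∘ `critM_at`): the
constrained criticality of Bałaban's regular minimiser in multiplier form, with the explicit onto derivative of the chart-read descent. [cite: Balaban1985Variational, Thm 1 (8)-(10) p.279, (26) p.282, (171) p.305] -/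
theorem critM_body_five (L : ℕ) (h5 : 5 ≤ L)
    (G : (F : T3Family) → (J : ℕ) → GaugeField (F.P J) 0 (Matrix.specialUnitaryGroup (Fin 2) ℂ) → Prop) :
    ∃ c₀ : ℝ, 0 < c₀ ∧ c₀ ≤ 1 ∧ ∀ (cw : ℝ), 0 < cw → cw ≤ c₀ → ∃ pS : ℝ, ∀ (b₀ p₀ : ℝ), 0 < b₀ → pS ≤ p₀ → 0 < p₀ → ∃ ε₁ : ℝ, 0 < ε₁ ∧ ∀ (ε₀ : ℝ), 0 < ε₀ → ε₀ ≤ ε₁ →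
    ∃ γ₁ : ℝ, 0 < γ₁ ∧ ∀ (F : T3Family) (γ : ℝ), F.L = L → 0 < γ → γ ≤ γ₁ →
      ∀ (J K : ℕ) (hJK : J ≤ K) (V : GaugeField (F.P J) 0 (Matrix.specialUnitaryGroup (Fin 2) ℂ)), PlaqSmall (θBal F.L γ (cw * b₀) p₀ J) V →
        G F J V →
        ∀ U₀ ∈ {U' : GaugeField (F.P K) 0 (Matrix.specialUnitaryGroup (Fin 2) ℂ) | U' ∈ fibre F ℰp J K hJK V ∧ U' ∈ histGood F ℰp (θBal F.L γ b₀ p₀) K J ∧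
            wilsonAction4 U' = minActionRegPr F J K hJK ε₀ V},
        (∃ lam : (PBond (F.P J) 0 → (specialUnitaryLogChart (Fin 2)).lie) → ℝ, ∀ ζ : PBond (F.P K) 0 → EuclideanSpace ℝ (Fin 3),
          (∑ p : Plaq (F.P K) 0, inner ℝ (imVec (su2Quat (GaugeField.plaqHol U₀ p)))
            (adSU2 (GaugeField.plaqHol U₀ p)⁻¹ (ζ ⟨p.src, p.μ⟩) + adSU2 ((GaugeField.plaqHol U₀ p)⁻¹ * U₀ ⟨p.src, p.μ⟩) (ζ ⟨p.src.shift p.μ, p.ν⟩) -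
              adSU2 ((GaugeField.plaqHol U₀ p)⁻¹ * U₀ ⟨p.src, p.μ⟩ * U₀ ⟨p.src.shift p.μ, p.ν⟩ * (U₀ ⟨p.src.shift p.ν, p.μ⟩)⁻¹) (ζ ⟨p.src.shift p.ν, p.μ⟩) -
              ζ ⟨p.src, p.ν⟩)) =
          lam (fderiv ℝ (fun (ζ : PBond (F.P K) 0 → EuclideanSpace ℝ (Fin 3)) (B : PBond (F.P J) 0) =>
            (isChartRep_specialUnitaryGroup (n := Fin 2)).logChart
              (descendTo F ℰp J K hJK (fun ℓ => expPoint (ζ ℓ) * U₀ ℓ) B * (descendTo F ℰp J K hJK U₀ B)⁻¹)) 0 ζ)) ∧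
        Function.Surjective (fderiv ℝ (fun (ζ : PBond (F.P K) 0 → EuclideanSpace ℝ (Fin 3)) (B : PBond (F.P J) 0) =>
            (isChartRep_specialUnitaryGroup (n := Fin 2)).logChart
              (descendTo F ℰp J K hJK (fun ℓ => expPoint (ζ ℓ) * U₀ ℓ) B * (descendTo F ℰp J K hJK U₀ B)⁻¹)) 0) := by
  obtain ⟨a₀, a₁, B₃, ha₀, ha₁, hB₃, hT1, hU1⟩ := thm1Pair_five L h5
  exact critM_at (by omega) ha₀ ha₁ hB₃ hT1 hU1 G

end Window

end Summit.QuantumFields.YangMills.Theorems.FluctuationComparisonRegPrIntLS2BetaCritMOfChartReadDescent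

end
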